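import Mathlib
import HarnessLib

/-!
# Number of solutions of diagonal quadratic equations over `F_q`, `q` odd
# (Lidl–Niederreiter, *Finite Fields*, Ch. 6 §2: 6.22–6.27, with Theorem 5.48)

[cite: LidlNiederreiter1996, Chapter 6, §2 (Quadratic forms), Definition 6.22 – Theorem 6.27;
Chapter 5, Theorem 5.48]

Let `q` be odd and `η = quadraticChar F` the quadratic character of `F = F_q`. For
`a : Fin n → F` and `b ∈ F` we write `diagQuadCount a b = N(a_0 x_0^2 + ⋯ + a_{n-1} x_{n-1}^2 = b)`
for the number of solutions in `F_q^n` (the text's `N(⋯)`, "considering only the indeterminates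
actually written down").

* **Definition 6.22** `quadV`: the integer-valued function `v` on `F_q` with `v(b) = -1` for
  `b ∈ F_q^*` and `v(0) = q - 1`.
* **Lemma 6.23** `sum_quadV` : `Σ_{c ∈ F_q} v(c) = 0` (6.4), and (6.5) in the two-summand form in
  which it is used below: `sum_quadV_mul_quadV_sub` : `Σ_{c_1 + c_2 = b} v(c_1) v(c_2) = v(b) q`
  (the case `k < m` of (6.5) reduces to (6.4): `sum_quadV_sub`).
* `card_mul_sq_eq` : `N(a x^2 = c) = 1 + η(c a⁻¹)` for `a ≠ 0` ((5.37) of the text; from Mathlib's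
  `quadraticChar_card_sqrts`), and `sum_quadraticChar_mul_sub_sq` :
  `Σ_{c ∈ F_q} η(bc - c^2) = v(b) η(-1)`, the instance of Theorem 5.48 quoted in the proof of 6.24
  (proved here directly by the substitution `c = bt`, `η(t(1 - t)) = η(t⁻¹ - 1)` for `t ≠ 0`).
* **Theorem 5.48** (Ch. 5 §4) `sum_quadraticChar_quadratic` : for `a_2 ≠ 0`,
  `Σ_{c ∈ F_q} η(a_2 c^2 + a_1 c + a_0) = η(a_2) v(a_1^2 - 4 a_0 a_2)`, i.e. `= -η(a_2)` if the
  discriminant is `≠ 0` and `= (q - 1) η(a_2)` if it is `0` (by completing the square and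
  `sum_quadraticChar_sq_sub_eq_quadV` : `Σ_u η(u^2 - e) = v(e)`, itself from the fibre count and
  6.24's sum; the case `e ≠ 0` is also `BakerLimitFormulaCharSums.sum_quadraticChar_sq_sub`).
* **Lemma 6.24** `diagQuadCount_two` : `N(a_1 x_1^2 + a_2 x_2^2 = b) = q + v(b) η(-a_1 a_2)` for
  `a_1, a_2 ∈ F_q^*`.
* **Theorem 6.26** (diagonal case) `diagQuadCount_even` : for `n = 2m + 2` even and all `a_i ≠ 0`,
  `N(a_1 x_1^2 + ⋯ + a_n x_n^2 = b) = q^{n-1} + v(b) q^{(n-2)/2} η((-1)^{n/2} a_1 ⋯ a_n)`.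
* **Theorem 6.27** (diagonal case) `diagQuadCount_odd` : for `n = 2m + 1` odd and all `a_i ≠ 0`,
  `N(a_1 x_1^2 + ⋯ + a_n x_n^2 = b) = q^{n-1} + q^{(n-1)/2} η((-1)^{(n-1)/2} b a_1 ⋯ a_n)`.

Proof organisation. As in the text's proof of Theorem 6.27 we split off one indeterminate,
`N(a_0 x_0^2 + g = b) = Σ_{c_1 + c_2 = b} N(a_0 x_0^2 = c_1) N(g = c_2)
  = Σ_{t ∈ F_q} (1 + η(t a_0⁻¹)) N(g = b - t)` (`diagQuadCount_succ`, `diagQuadCount_succ_eq_sum`),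
and run ONE induction on `m` proving 6.27 for `n = 2m + 1` and 6.26 for `n = 2m + 2` together
(`diagQuadCount_odd_and_even`): the step `2m + 1 → 2m + 2` needs `Σ_t η(t) η(b - t) = v(b) η(-1)`
(`sum_quadraticChar_mul_quadraticChar_sub`, i.e. Lemma 6.24's character sum) and the step
`2m + 2 → 2m + 3` needs `Σ_t η(t) v(b - t) = q η(b)` (`sum_quadraticChar_mul_quadV_sub`),
exactly the two evaluations of the text's proofs; the text proves 6.26 by grouping the
indeterminates in pairs and using the `m`-fold form of (6.5) instead. In the statements `n - 1`,
`(n - 2)/2`, `(n - 1)/2` are written out as `2m + 1`, `m` (for `n = 2m + 2`) and `2m`, `m` (for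
`n = 2m + 1`), so that no truncated subtraction occurs, and the determinant `Δ = det(f)` of the
diagonal form is `a_1 ⋯ a_n`.

NOT restated here: Theorem 6.21 (every quadratic form over `F_q`, `q` odd, is equivalent to a
diagonal one) and hence 6.26/6.27 for a general nondegenerate `f` with `Δ = det(f)`; the `m`-fold
convolution form of (6.5); Remark 6.25; Theorems 6.30–6.32 (`q` even).
-/

open Finset

namespace Literature.NumberTheory.QuadraticForms.FiniteFieldDiagonalCount

variable {F : Type*} [Field F] [Fintype F] [DecidableEq F]

/-- **Definition 6.22.** `v(b) = -1` for `b ∈ F_q^*` and `v(0) = q - 1`.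
[cite: LidlNiederreiter1996, Definition 6.22] -/
def quadV (b : F) : ℤ := if b = 0 then (Fintype.card F : ℤ) - 1 else -1

/-- `diagQuadCount a b = N(a_0 x_0^2 + ⋯ + a_{n-1} x_{n-1}^2 = b)`, the number of solutions
`x ∈ F_q^n` of the diagonal quadratic equation (the text's `N(⋯)` notation introduced after
Lemma 6.23). [cite: LidlNiederreiter1996, Lemma 6.24] -/
def diagQuadCount {n : ℕ} (a : Fin n → F) (b : F) : ℕ :=
  Fintype.card {x : Fin n → F // ∑ i, a i * x i ^ 2 = b}

/-- `v(b) = q·[b = 0] - 1`. [cite: LidlNiederreiter1996, Definition 6.22] -/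
theorem quadV_eq (b : F) : quadV b = (if b = 0 then (Fintype.card F : ℤ) else 0) - 1 := by
  unfold quadV; split_ifs <;> ring

/-- `Σ_c v(c) g(c) = q g(0) - Σ_c g(c)` for any `g : F_q → ℤ` (the way `v` enters
character-sum computations, cf. the proof of Theorem 6.27).
[cite: LidlNiederreiter1996, Definition 6.22] -/
theorem sum_quadV_mul (g : F → ℤ) :
    ∑ c : F, quadV c * g c = Fintype.card F * g 0 - ∑ c : F, g c := by
  simp_rw [quadV_eq, sub_mul, one_mul, sum_sub_distrib, ite_mul, zero_mul, sum_ite_eq' univ,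
    if_pos (mem_univ _)]

/-- **Lemma 6.23, (6.4).** `Σ_{c ∈ F_q} v(c) = 0`. [cite: LidlNiederreiter1996, Lemma 6.23] -/
theorem sum_quadV : ∑ c : F, quadV c = 0 := by
  have h := sum_quadV_mul (fun _ : F => (1 : ℤ))
  simp_rw [mul_one, sum_const, card_univ, nsmul_eq_mul, mul_one] at h
  rw [h, sub_self]

/-- **Lemma 6.23, (6.4)**, shifted: `Σ_{c ∈ F_q} v(b - c) = 0`.
[cite: LidlNiederreiter1996, Lemma 6.23] -/
theorem sum_quadV_sub (b : F) : ∑ c : F, quadV (b - c) = 0 := by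
  rw [show ∑ c : F, quadV (b - c) = ∑ c : F, quadV c from Equiv.sum_comp (Equiv.subLeft b) quadV,
    sum_quadV]

/-- **Lemma 6.23, (6.5)** for `m = k = 2`: `Σ_{c_1 + c_2 = b} v(c_1) v(c_2) = v(b) q`, written as
a sum over `c_1 = c` with `c_2 = b - c`. [cite: LidlNiederreiter1996, Lemma 6.23] -/
theorem sum_quadV_mul_quadV_sub (b : F) :
    ∑ c : F, quadV c * quadV (b - c) = quadV b * Fintype.card F := by
  rw [sum_quadV_mul, sub_zero, sum_quadV_sub, sub_zero, mul_comm]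

/-- `η(a⁻¹) = η(a)`. [folklore] -/
private theorem quadraticChar_inv' (a : F) : quadraticChar F a⁻¹ = quadraticChar F a := by
  rcases eq_or_ne a 0 with rfl | ha
  · rw [inv_zero]
  · have h : quadraticChar F a⁻¹ * quadraticChar F a = 1 := by
      rw [← map_mul, inv_mul_cancel₀ ha, map_one]
    rcases quadraticChar_dichotomy ha with h1 | h1 <;> rw [h1] at h ⊢ <;> linarith

/-- `Σ_{c ∈ F_q} η(b - c) = 0` for the quadratic character `η` of `F_q`, `q` odd ((5.12) of the
text). [cite: LidlNiederreiter1996, Theorem 5.4] -/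
theorem sum_quadraticChar_const_sub (hF : ringChar F ≠ 2) (b : F) :
    ∑ c : F, quadraticChar F (b - c) = 0 := by
  rw [show ∑ c : F, quadraticChar F (b - c) = ∑ c : F, quadraticChar F c from
    Equiv.sum_comp (Equiv.subLeft b) (quadraticChar F), quadraticChar_sum_zero hF]

/-- `Σ_{t ∈ F_q} η(t) v(b - t) = q η(b)` (`q` odd; the evaluation behind the induction step of
Theorem 6.27). [cite: LidlNiederreiter1996, Theorem 6.27] -/
theorem sum_quadraticChar_mul_quadV_sub (hF : ringChar F ≠ 2) (b : F) :
    ∑ t : F, quadraticChar F t * quadV (b - t) = Fintype.card F * quadraticChar F b := by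
  have h := sum_quadV_mul (fun c => quadraticChar F (b - c))
  rw [sub_zero, sum_quadraticChar_const_sub hF, sub_zero] at h
  rw [← h, ← Equiv.sum_comp (Equiv.subLeft b)]
  exact sum_congr rfl fun c _ => by simp only [Equiv.subLeft_apply, sub_sub_cancel, mul_comm]

/-- `N(a x^2 = c) = 1 + η(c a⁻¹)` for `a ≠ 0`, `q` odd ((5.37) of the text, used in the
proof of Lemma 6.24). [cite: LidlNiederreiter1996, Lemma 6.24] -/
theorem card_mul_sq_eq (hF : ringChar F ≠ 2) {a : F} (ha : a ≠ 0) (c : F) :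
    (Fintype.card {x : F // a * x ^ 2 = c} : ℤ) = 1 + quadraticChar F (c * a⁻¹) := by
  have h := quadraticChar_card_sqrts hF (c * a⁻¹)
  rw [Set.toFinset_card] at h
  rw [add_comm, ← h]
  exact congrArg Nat.cast (Fintype.card_congr (Equiv.subtypeEquivRight fun x => by
    rw [Set.mem_setOf_eq, eq_mul_inv_iff_mul_eq₀ ha, mul_comm]))

/-- The character sum `Σ_{c ∈ F_q} η(bc - c^2) = v(b) η(-1)` (`q` odd; the instance of
Theorem 5.48 used in the proof of Lemma 6.24). [cite: LidlNiederreiter1996, Lemma 6.24] -/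
theorem sum_quadraticChar_mul_sub_sq (hF : ringChar F ≠ 2) (b : F) :
    ∑ c : F, quadraticChar F (b * c - c ^ 2) = quadV b * quadraticChar F (-1) := by
  rcases eq_or_ne b 0 with rfl | hb
  · have h1 : ∀ c : F, quadraticChar F (0 * c - c ^ 2) =
        if c ≠ 0 then quadraticChar F (-1) else 0 := by
      intro c
      split_ifs with hc
      · rw [zero_mul, zero_sub, neg_eq_neg_one_mul, map_mul, quadraticChar_sq_one' hc, mul_one]
      · rw [not_ne_iff.mp hc]; simp
    rw [sum_congr rfl fun c _ => h1 c, sum_ite, sum_const_zero, add_zero, sum_const, filter_ne',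
      card_erase_of_mem (mem_univ _), card_univ, quadV, if_pos rfl, nsmul_eq_mul,
      Nat.cast_sub Fintype.card_pos, Nat.cast_one]
  · have key : ∑ t : F, quadraticChar F (t * (1 - t)) = -quadraticChar F (-1) := by
      have h1 : ∀ t : F, quadraticChar F (t * (1 - t)) =
          quadraticChar F (t⁻¹ - 1) - if t = 0 then quadraticChar F (-1) else 0 := by
        intro t
        split_ifs with ht
        · rw [ht, zero_mul, inv_zero, zero_sub, quadraticChar_zero, sub_self]
        · rw [sub_zero, show t * (1 - t) = t ^ 2 * (t⁻¹ - 1) by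
            rw [mul_sub, mul_one, mul_sub, mul_one, pow_two, mul_assoc, mul_inv_cancel₀ ht,
              mul_one], map_mul, quadraticChar_sq_one' ht, one_mul]
      rw [sum_congr rfl fun t _ => h1 t, sum_sub_distrib, sum_ite_eq' univ (0 : F),
        if_pos (mem_univ _),
        show ∑ t : F, quadraticChar F (t⁻¹ - 1) = ∑ t : F, quadraticChar F (t - 1) from
          Equiv.sum_comp (Equiv.inv F) (fun t => quadraticChar F (t - 1)),
        show ∑ t : F, quadraticChar F (t - 1) = ∑ t : F, quadraticChar F t from
          Equiv.sum_comp (Equiv.subRight (1 : F)) (quadraticChar F),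
        quadraticChar_sum_zero hF, zero_sub]
    calc ∑ c : F, quadraticChar F (b * c - c ^ 2)
        = ∑ t : F, quadraticChar F (b * (b * t) - (b * t) ^ 2) :=
          (Equiv.sum_comp (Equiv.mulLeft₀ b hb) _).symm
      _ = ∑ t : F, quadraticChar F (t * (1 - t)) := sum_congr rfl fun t _ => by
          rw [show b * (b * t) - (b * t) ^ 2 = b ^ 2 * (t * (1 - t)) by ring, map_mul,
            quadraticChar_sq_one' hb, one_mul]
      _ = quadV b * quadraticChar F (-1) := by rw [key, quadV, if_neg hb]; ring

/-- `Σ_{t ∈ F_q} η(t) η(b - t) = v(b) η(-1)` (`q` odd; the form in which the previous sum is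
used in the proofs of Lemma 6.24 and Theorem 6.26). [cite: LidlNiederreiter1996, Lemma 6.24] -/
theorem sum_quadraticChar_mul_quadraticChar_sub (hF : ringChar F ≠ 2) (b : F) :
    ∑ t : F, quadraticChar F t * quadraticChar F (b - t) = quadV b * quadraticChar F (-1) := by
  rw [← sum_quadraticChar_mul_sub_sq hF b]
  exact sum_congr rfl fun t _ => by rw [← map_mul]; ring_nf

/-- Summing over the fibres of `y ↦ c y^2`:
`Σ_{y ∈ F_q} g(c y^2) = Σ_{t ∈ F_q} (1 + η(t c⁻¹)) g(t)` for `c ≠ 0`, `q` odd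
(by `N(c y^2 = t) = 1 + η(t c⁻¹)`). [cite: LidlNiederreiter1996, Lemma 6.24] -/
theorem sum_comp_mul_sq (hF : ringChar F ≠ 2) {c : F} (hc : c ≠ 0) (g : F → ℤ) :
    ∑ y : F, g (c * y ^ 2) = ∑ t : F, (1 + quadraticChar F (t * c⁻¹)) * g t := by
  rw [← Fintype.sum_fiberwise' (fun y : F => c * y ^ 2) g]
  refine sum_congr rfl fun t _ => ?_
  rw [sum_const, card_univ, ← card_mul_sq_eq hF hc t, nsmul_eq_mul]

/-- `Σ_{u ∈ F_q} η(u^2 - e) = v(e)` (`q` odd): the normalised case of Theorem 5.48.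
[cite: LidlNiederreiter1996, Theorem 5.48] -/
theorem sum_quadraticChar_sq_sub_eq_quadV (hF : ringChar F ≠ 2) (e : F) :
    ∑ u : F, quadraticChar F (u ^ 2 - e) = quadV e := by
  have h := sum_comp_mul_sq hF (one_ne_zero (α := F)) fun w => quadraticChar F (w - e)
  simp_rw [one_mul, inv_one, mul_one, add_mul, one_mul, sum_add_distrib] at h
  rw [h, show ∑ w : F, quadraticChar F (w - e) = ∑ w : F, quadraticChar F w from
    Equiv.sum_comp (Equiv.subRight e) (quadraticChar F), quadraticChar_sum_zero hF, zero_add]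
  have h1 : ∀ w : F, quadraticChar F w * quadraticChar F (w - e) =
      quadraticChar F (-1) * (quadraticChar F w * quadraticChar F (e - w)) := by
    intro w; rw [← neg_sub e w, neg_eq_neg_one_mul, map_mul]; ring
  rw [sum_congr rfl fun w _ => h1 w, ← mul_sum, sum_quadraticChar_mul_quadraticChar_sub hF,
    mul_comm (quadV e), ← mul_assoc, ← pow_two, quadraticChar_sq_one (neg_ne_zero.2 one_ne_zero),
    one_mul]

/-- **Theorem 5.48.** For `q` odd and `f(x) = a_2 x^2 + a_1 x + a_0 ∈ F_q[x]` with `a_2 ≠ 0`: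
`Σ_{c ∈ F_q} η(f(c)) = -η(a_2)` if `d = a_1^2 - 4 a_0 a_2 ≠ 0` and `= (q - 1) η(a_2)` if `d = 0`;
both cases at once: `Σ_c η(f(c)) = η(a_2) v(d)`. [cite: LidlNiederreiter1996, Theorem 5.48] -/
theorem sum_quadraticChar_quadratic (hF : ringChar F ≠ 2) {a₂ : F} (ha₂ : a₂ ≠ 0) (a₁ a₀ : F) :
    ∑ c : F, quadraticChar F (a₂ * c ^ 2 + a₁ * c + a₀) =
      quadraticChar F a₂ * quadV (a₁ ^ 2 - 4 * a₀ * a₂) := by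
  have h2 : (2 : F) ≠ 0 := Ring.two_ne_zero hF
  have h4 : (4 : F) ≠ 0 := by rw [show (4 : F) = 2 * 2 by norm_num]; exact mul_ne_zero h2 h2
  set e : F := (a₁ ^ 2 - 4 * a₀ * a₂) / (4 * a₂ ^ 2) with he
  have hcs : ∀ c : F, a₂ * c ^ 2 + a₁ * c + a₀ = a₂ * ((c + a₁ / (2 * a₂)) ^ 2 - e) := by
    intro c; rw [he]; field_simp; ring
  have hv : quadV e = quadV (a₁ ^ 2 - 4 * a₀ * a₂) := by
    have h0 : e = 0 ↔ a₁ ^ 2 - 4 * a₀ * a₂ = 0 := by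
      rw [he, div_eq_zero_iff, or_iff_left (mul_ne_zero h4 (pow_ne_zero 2 ha₂))]
    simp only [quadV, h0]
  calc ∑ c : F, quadraticChar F (a₂ * c ^ 2 + a₁ * c + a₀)
      = quadraticChar F a₂ * ∑ c : F, quadraticChar F ((c + a₁ / (2 * a₂)) ^ 2 - e) := by
        rw [mul_sum]; exact sum_congr rfl fun c _ => by rw [hcs, map_mul]
    _ = quadraticChar F a₂ * ∑ u : F, quadraticChar F (u ^ 2 - e) :=
        congrArg (quadraticChar F a₂ * ·)
          (Equiv.sum_comp (Equiv.addRight (a₁ / (2 * a₂))) fun u => quadraticChar F (u ^ 2 - e))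
    _ = quadraticChar F a₂ * quadV (a₁ ^ 2 - 4 * a₀ * a₂) := by
        rw [sum_quadraticChar_sq_sub_eq_quadV hF, hv]

/-- Splitting off the first indeterminate:
`N(a_0 x_0^2 + a_1 x_1^2 + ⋯ + a_n x_n^2 = b)
  = Σ_{y ∈ F_q} N(a_1 x_1^2 + ⋯ + a_n x_n^2 = b - a_0 y^2)`
(the decomposition `N(f = b) = Σ_{c_1 + c_2 = b} N(g = c_1) N(a x^2 = c_2)` of the proof of
Theorem 6.27). [cite: LidlNiederreiter1996, Theorem 6.27] -/
theorem diagQuadCount_succ {n : ℕ} (a : Fin (n + 1) → F) (b : F) :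
    diagQuadCount a b = ∑ y : F, diagQuadCount (Fin.tail a) (b - a 0 * y ^ 2) := by
  unfold diagQuadCount
  rw [← Fintype.card_sigma]
  refine Fintype.card_congr ((Equiv.subtypeEquiv (Fin.consEquiv fun _ => F).symm ?_).trans
    (Equiv.subtypeProdEquivSigmaSubtype fun (y : F) (x : Fin n → F) =>
      ∑ i, Fin.tail a i * x i ^ 2 = b - a 0 * y ^ 2))
  intro x
  rw [Fin.sum_univ_succ, eq_sub_iff_add_eq']
  exact Iff.rfl

/-- Splitting off the first indeterminate and counting `N(a_0 y^2 = t) = 1 + η(t a_0⁻¹)`: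
`N(a_0 x_0^2 + ⋯ + a_n x_n^2 = b)
  = Σ_{t ∈ F_q} (1 + η(t a_0⁻¹)) N(a_1 x_1^2 + ⋯ + a_n x_n^2 = b - t)`
(`q` odd, `a_0 ≠ 0`; proof of Theorem 6.27). [cite: LidlNiederreiter1996, Theorem 6.27] -/
theorem diagQuadCount_succ_eq_sum (hF : ringChar F ≠ 2) {n : ℕ} (a : Fin (n + 1) → F)
    (ha : a 0 ≠ 0) (b : F) :
    (diagQuadCount a b : ℤ) =
      ∑ t : F, (1 + quadraticChar F (t * (a 0)⁻¹)) * diagQuadCount (Fin.tail a) (b - t) := by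
  rw [diagQuadCount_succ, Nat.cast_sum]
  exact sum_comp_mul_sq hF ha fun t => (diagQuadCount (Fin.tail a) (b - t) : ℤ)

/-- One indeterminate: `N(a_0 x_0^2 = b) = 1 + η(b a_0)` (`q` odd, `a_0 ≠ 0`; (5.37) of the
text). [cite: LidlNiederreiter1996, Lemma 6.24] -/
theorem diagQuadCount_one (hF : ringChar F ≠ 2) (a : Fin 1 → F) (ha : a 0 ≠ 0) (b : F) :
    (diagQuadCount a b : ℤ) = 1 + quadraticChar F (b * a 0) := by
  have h : diagQuadCount a b = Fintype.card {y : F // a 0 * y ^ 2 = b} :=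
    Fintype.card_congr (Equiv.subtypeEquiv (Equiv.funUnique (Fin 1) F) fun x => by
      rw [Fin.sum_univ_one]; exact Iff.rfl)
  rw [h, card_mul_sq_eq hF ha, map_mul, quadraticChar_inv', ← map_mul]

/-- The bookkeeping identity behind both induction steps. [folklore] -/
private theorem diagQuadCount_step_sum (hF : ringChar F ≠ 2) (c : F) (P K : ℤ) (G : F → ℤ) :
    ∑ t : F, (1 + quadraticChar F (t * c⁻¹)) * (P + K * G t) =
      Fintype.card F * P + K * ∑ t : F, G t +
        K * quadraticChar F c * ∑ t : F, quadraticChar F t * G t := by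
  have h : ∀ t : F, (1 + quadraticChar F (t * c⁻¹)) * (P + K * G t) =
      P + K * G t + P * quadraticChar F c * quadraticChar F t +
        K * quadraticChar F c * (quadraticChar F t * G t) := by
    intro t; rw [map_mul, quadraticChar_inv']; ring
  simp_rw [h, sum_add_distrib, ← mul_sum, sum_const, card_univ, nsmul_eq_mul]
  rw [quadraticChar_sum_zero hF, mul_zero, add_zero]

/-- Induction step `n = 2m + 1 → n = 2m + 2` (proof of Theorem 6.26 via Theorem 6.27).
[cite: LidlNiederreiter1996, Theorem 6.26] -/
private theorem diagQuadCount_even_of_odd (hF : ringChar F ≠ 2) (m : ℕ)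
    (hodd : ∀ (a : Fin (2 * m + 1) → F), (∀ i, a i ≠ 0) → ∀ b : F,
      (diagQuadCount a b : ℤ) = (Fintype.card F : ℤ) ^ (2 * m) +
        (Fintype.card F : ℤ) ^ m * quadraticChar F ((-1) ^ m * b * ∏ i, a i))
    (a : Fin (2 * m + 2) → F) (ha : ∀ i, a i ≠ 0) (b : F) :
    (diagQuadCount a b : ℤ) = (Fintype.card F : ℤ) ^ (2 * m + 1) +
      quadV b * (Fintype.card F : ℤ) ^ m * quadraticChar F ((-1) ^ (m + 1) * ∏ i, a i) := by
  rw [diagQuadCount_succ_eq_sum hF a (ha 0) b]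
  have htail : ∀ s : F, (diagQuadCount (Fin.tail a) s : ℤ) = (Fintype.card F : ℤ) ^ (2 * m) +
      (Fintype.card F : ℤ) ^ m * quadraticChar F ((-1) ^ m * ∏ i, Fin.tail a i) *
        quadraticChar F s := by
    intro s
    rw [hodd (Fin.tail a) (fun i => ha i.succ) s, mul_right_comm ((-1 : F) ^ m) s, map_mul,
      mul_assoc]
  simp_rw [htail]
  rw [diagQuadCount_step_sum hF (a 0), sum_quadraticChar_const_sub hF, mul_zero, add_zero,
    sum_quadraticChar_mul_quadraticChar_sub hF]
  conv_rhs => rw [Fin.prod_univ_succ]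
  simp only [Fin.tail, map_mul, map_pow, pow_succ, pow_mul]
  ring

/-- Induction step `n = 2m + 2 → n = 2m + 3` (proof of Theorem 6.27 via Theorem 6.26).
[cite: LidlNiederreiter1996, Theorem 6.27] -/
private theorem diagQuadCount_odd_of_even (hF : ringChar F ≠ 2) (m : ℕ)
    (heven : ∀ (a : Fin (2 * m + 2) → F), (∀ i, a i ≠ 0) → ∀ b : F,
      (diagQuadCount a b : ℤ) = (Fintype.card F : ℤ) ^ (2 * m + 1) +
        quadV b * (Fintype.card F : ℤ) ^ m * quadraticChar F ((-1) ^ (m + 1) * ∏ i, a i))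
    (a : Fin (2 * m + 3) → F) (ha : ∀ i, a i ≠ 0) (b : F) :
    (diagQuadCount a b : ℤ) = (Fintype.card F : ℤ) ^ (2 * m + 2) +
      (Fintype.card F : ℤ) ^ (m + 1) * quadraticChar F ((-1) ^ (m + 1) * b * ∏ i, a i) := by
  rw [diagQuadCount_succ_eq_sum hF a (ha 0) b]
  have htail : ∀ s : F, (diagQuadCount (Fin.tail a) s : ℤ) = (Fintype.card F : ℤ) ^ (2 * m + 1) +
      (Fintype.card F : ℤ) ^ m * quadraticChar F ((-1) ^ (m + 1) * ∏ i, Fin.tail a i) *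
        quadV s := by
    intro s
    rw [heven (Fin.tail a) (fun i => ha i.succ) s]; ring
  simp_rw [htail]
  rw [diagQuadCount_step_sum hF (a 0), sum_quadV_sub, mul_zero, add_zero,
    sum_quadraticChar_mul_quadV_sub hF]
  conv_rhs => rw [Fin.prod_univ_succ]
  simp only [Fin.tail, map_mul, map_pow, pow_succ, pow_mul]
  ring

/-- Theorems 6.27 and 6.26 (diagonal case) proved jointly by induction on `m`.
[cite: LidlNiederreiter1996, Theorem 6.26] -/
private theorem diagQuadCount_odd_and_even (hF : ringChar F ≠ 2) (m : ℕ) :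
    (∀ (a : Fin (2 * m + 1) → F), (∀ i, a i ≠ 0) → ∀ b : F,
      (diagQuadCount a b : ℤ) = (Fintype.card F : ℤ) ^ (2 * m) +
        (Fintype.card F : ℤ) ^ m * quadraticChar F ((-1) ^ m * b * ∏ i, a i)) ∧
    (∀ (a : Fin (2 * m + 2) → F), (∀ i, a i ≠ 0) → ∀ b : F,
      (diagQuadCount a b : ℤ) = (Fintype.card F : ℤ) ^ (2 * m + 1) +
        quadV b * (Fintype.card F : ℤ) ^ m * quadraticChar F ((-1) ^ (m + 1) * ∏ i, a i)) := by
  induction m with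
  | zero =>
    have hodd : ∀ (a : Fin (2 * 0 + 1) → F), (∀ i, a i ≠ 0) → ∀ b : F,
        (diagQuadCount a b : ℤ) = (Fintype.card F : ℤ) ^ (2 * 0) +
          (Fintype.card F : ℤ) ^ 0 * quadraticChar F ((-1) ^ 0 * b * ∏ i, a i) := by
      intro a ha b
      rw [diagQuadCount_one hF a (ha 0) b, Fin.prod_univ_one]; ring_nf
    exact ⟨hodd, diagQuadCount_even_of_odd hF 0 hodd⟩
  | succ m ih =>
    have hodd := diagQuadCount_odd_of_even hF m ih.2
    exact ⟨hodd, diagQuadCount_even_of_odd hF (m + 1) hodd⟩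

/-- **Lemma 6.24.** For odd `q`, `b ∈ F_q`, `a_1, a_2 ∈ F_q^*`:
`N(a_1 x_1^2 + a_2 x_2^2 = b) = q + v(b) η(-a_1 a_2)` (here `η` is the quadratic character of
`F_q`). [cite: LidlNiederreiter1996, Lemma 6.24] -/
theorem diagQuadCount_two (hF : ringChar F ≠ 2) {a₁ a₂ : F} (ha₁ : a₁ ≠ 0) (ha₂ : a₂ ≠ 0)
    (b : F) :
    (diagQuadCount ![a₁, a₂] b : ℤ) =
      Fintype.card F + quadV b * quadraticChar F (-(a₁ * a₂)) := by
  have h := (diagQuadCount_odd_and_even hF 0).2 ![a₁, a₂]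
    (fun i => by fin_cases i <;> assumption) b
  rw [h, Fin.prod_univ_two]
  simp

/-- **Theorem 6.26** (diagonal case). For odd `q`, a nondegenerate diagonal quadratic form
`a_1 x_1^2 + ⋯ + a_n x_n^2` in an even number `n = 2m + 2` of indeterminates and `b ∈ F_q`:
`N(a_1 x_1^2 + ⋯ + a_n x_n^2 = b) = q^{n-1} + v(b) q^{(n-2)/2} η((-1)^{n/2} a_1 ⋯ a_n)`.
[cite: LidlNiederreiter1996, Theorem 6.26] -/
theorem diagQuadCount_even (hF : ringChar F ≠ 2) (m : ℕ) (a : Fin (2 * m + 2) → F)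
    (ha : ∀ i, a i ≠ 0) (b : F) :
    (diagQuadCount a b : ℤ) = (Fintype.card F : ℤ) ^ (2 * m + 1) +
      quadV b * (Fintype.card F : ℤ) ^ m * quadraticChar F ((-1) ^ (m + 1) * ∏ i, a i) :=
  (diagQuadCount_odd_and_even hF m).2 a ha b

/-- **Theorem 6.27** (diagonal case). For odd `q`, a nondegenerate diagonal quadratic form in an
odd number `n = 2m + 1` of indeterminates and `b ∈ F_q`:
`N(a_1 x_1^2 + ⋯ + a_n x_n^2 = b) = q^{n-1} + q^{(n-1)/2} η((-1)^{(n-1)/2} b a_1 ⋯ a_n)`.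
[cite: LidlNiederreiter1996, Theorem 6.27] -/
theorem diagQuadCount_odd (hF : ringChar F ≠ 2) (m : ℕ) (a : Fin (2 * m + 1) → F)
    (ha : ∀ i, a i ≠ 0) (b : F) :
    (diagQuadCount a b : ℤ) = (Fintype.card F : ℤ) ^ (2 * m) +
      (Fintype.card F : ℤ) ^ m * quadraticChar F ((-1) ^ m * b * ∏ i, a i) :=
  (diagQuadCount_odd_and_even hF m).1 a ha b

end Literature.NumberTheory.QuadraticForms.FiniteFieldDiagonalCount
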